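import Summits.ResolutionOfSingularities.ResolutionOfSingularities.Theorems.FrobeniusClosingPatchingRelPerfectLetterTower
import HarnessLib

/-!
# Crux `PatchingRelPerfect` (stmt-ResolutionOfSingularities-16161), chain w52 — rung toolkit:
# generic ideal identities for the level-two charts of the contact-migration member

[OURS · L1 W5.2 · rung tool] The companion of the member `(x₀x₁ + x₂² + x₃³) + 𝔪⁴` (this seat's
PLAN-A2-certificate.md, addendum 3) is built from the level-one pieces `M_{k,m} = (z) + uᵏ 𝔫₀ᵐ` on the
vertex chart `B₃` (`z = u + q̃`, `𝔫₀ = (u, e₀, e₁, e₂)`).  On a chart of `Bl_{𝔫₀}` with exceptional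
generator `w`, `ψ(𝔫₀) = (w)` and either `ψ z = w c`, `ψ u = w u'` with `u' = c - w h` (the `e`-charts) or
`ψ z = w (1 + w q)`, `ψ u = w` (the `u`-chart).  PROVED, over arbitrary commutative rings:

* `map_span_sup_pow_mul_pow` — `ψ((z) + uᵏ 𝔫ᵐ) = (w) · (c, w^{k+m-1} u'ᵏ)` (`k + m ≥ 1`);
* `span_pair_mul_sub_mul_pow` — `(c, X (c - w h)ᵏ) = (c, X wᵏ hᵏ)` (so the factor is the flag factor
  `(c, w^{2k+m-1} hᵏ)` of the letter tower, `span_pair_flag`);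
* `map_span_sup_pow_mul_pow_of_unit` — on the `u`-chart `ψ((z) + uᵏ 𝔫ᵐ) = (w)` (`k + m ≥ 1`):
  `(w (1 + w q), wʲ) = (w)` (`span_pair_one_add_mul`).

Nothing here is a statement of the manuscript under review.

## References

* The Stacks Project, Tags 080B, 0804. [StacksProject]
* U. Görtz, T. Wedhorn, *Algebraic Geometry I*, 2nd ed. 2020, (13.19). [GortzWedhorn2020]
-/

-- `Summit.<Summit>.<Sub>.Theorems` with `Sub = Summit` (single-conjunct summit, D-0017)
set_option linter.dupNamespace false

noncomputable section

open CategoryTheory CategoryTheory.Limits AlgebraicGeometry Literature.AlgebraicGeometry.Resolution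
open IsLocalRing

namespace Summit.ResolutionOfSingularities.ResolutionOfSingularities.Theorems

namespace ConeRung

section Generic

variable {R B : Type*} [CommRing R] [CommRing B]

/-- `(c, X (c - w h)ᵏ) = (c, X wᵏ hᵏ)` — modulo `c`, `(c - w h)ᵏ ≡ (-w h)ᵏ`. [folklore] -/
theorem span_pair_mul_sub_mul_pow (c w h X : B) (k : ℕ) :
    Ideal.span {c, X * (c - w * h) ^ k} = Ideal.span {c, X * (w ^ k * h ^ k)} := by
  -- `(c - w h)ᵏ = (-(w h))ᵏ + c r` for some `r`
  obtain ⟨r, hr⟩ : ∃ r : B, (c - w * h) ^ k = (-(w * h)) ^ k + c * r := by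
    have h1 : c ∣ (c - w * h) ^ k - (-(w * h)) ^ k := by
      have := sub_dvd_pow_sub_pow (c - w * h) (-(w * h)) k
      rwa [show c - w * h - -(w * h) = c by ring] at this
    obtain ⟨r, hr⟩ := h1
    exact ⟨r, by rw [← hr]; ring⟩
  have hsgn : ∃ ε : B, ε * ε = 1 ∧ (-(w * h)) ^ k = ε * (w ^ k * h ^ k) := by
    refine ⟨(-1) ^ k, ?_, ?_⟩
    · rw [← mul_pow, neg_one_mul, neg_neg, one_pow]
    · rw [neg_eq_neg_one_mul, mul_pow, mul_pow]
  obtain ⟨ε, hε, hk⟩ := hsgn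
  rw [hr, hk]
  apply le_antisymm
  · rw [Ideal.span_le]
    rintro y (rfl | rfl)
    · exact Ideal.subset_span (by simp)
    · have e : X * (ε * (w ^ k * h ^ k) + c * r) = (X * r) * c + ε * (X * (w ^ k * h ^ k)) := by
        ring
      rw [e]
      exact Ideal.add_mem _ (Ideal.mul_mem_left _ _ (Ideal.subset_span (by simp)))
        (Ideal.mul_mem_left _ _ (Ideal.subset_span (by simp)))
  · rw [Ideal.span_le]
    rintro y (rfl | rfl)
    · exact Ideal.subset_span (by simp)
    · have e : X * (w ^ k * h ^ k) = ε * (X * (ε * (w ^ k * h ^ k) + c * r)) - (ε * X * r) * c := by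
        have : ε * ε * (X * (w ^ k * h ^ k)) = X * (w ^ k * h ^ k) := by rw [hε, one_mul]
        rw [← this]
        ring
      rw [e]
      exact Ideal.sub_mem _ (Ideal.mul_mem_left _ _ (Ideal.subset_span (by simp)))
        (Ideal.mul_mem_left _ _ (Ideal.subset_span (by simp)))

/-- **The flag factor**: with `u' = c - w h`, `(c, w^j u'ᵏ) = (c, w^{k+j} hᵏ)`. [folklore] -/
theorem span_pair_flag (c w h : B) (k j : ℕ) :
    Ideal.span {c, w ^ j * (c - w * h) ^ k} = Ideal.span {c, w ^ (k + j) * h ^ k} := by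
  rw [span_pair_mul_sub_mul_pow, ← mul_assoc, ← pow_add, add_comm]

/-- `(w (1 + w q), wʲ) = (w)` for `j ≥ 1`: `1 + w q` is a unit modulo `w`. [folklore] -/
theorem span_pair_one_add_mul (w q : B) (j : ℕ) (hj : 1 ≤ j) :
    Ideal.span {w * (1 + w * q), w ^ j} = Ideal.span {w} := by
  apply le_antisymm
  · rw [Ideal.span_le]
    rintro y (rfl | rfl)
    · exact Ideal.mul_mem_right _ _ (Ideal.mem_span_singleton_self w)
    · obtain ⟨i, rfl⟩ := Nat.exists_eq_add_of_le hj
      rw [pow_add, pow_one]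
      exact Ideal.mul_mem_right _ _ (Ideal.mem_span_singleton_self w)
  · rw [Ideal.span_singleton_le_iff_mem]
    -- `1 = (1 + w q) A + (-w q)ʲ`, so `w = A · w(1 + w q) + ((-1)ʲ qʲ w) · wʲ`
    obtain ⟨A, hA⟩ : (1 + w * q) ∣ 1 - (-(w * q)) ^ j := by
      have := sub_dvd_pow_sub_pow (1 : B) (-(w * q)) j
      rwa [one_pow, show (1 : B) - -(w * q) = 1 + w * q by ring] at this
    have h3 : (-(w * q)) ^ j = (-1) ^ j * (w ^ j * q ^ j) := by
      rw [neg_eq_neg_one_mul, mul_pow, mul_pow]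
    rw [h3] at hA
    have e : w = A * (w * (1 + w * q)) + ((-1) ^ j * q ^ j * w) * w ^ j := by
      linear_combination w * hA
    have hmem : A * (w * (1 + w * q)) + ((-1) ^ j * q ^ j * w) * w ^ j ∈
        Ideal.span {w * (1 + w * q), w ^ j} :=
      Ideal.add_mem _ (Ideal.mul_mem_left _ _ (Ideal.subset_span (by simp)))
        (Ideal.mul_mem_left _ _ (Ideal.subset_span (by simp)))
    rw [← e] at hmem
    exact hmem

/-- **The `e`-charts**: `ψ z = w c`, `ψ u = w u'`, `ψ(𝔫) = (w)` ⇒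
`ψ((z) + uᵏ 𝔫ᵐ) = (w) · (c, w^{k+m-1} u'ᵏ)` for `k + m ≥ 1`. [cite: StacksProject, Tag 080B] -/
theorem map_span_sup_pow_mul_pow (ψ : R →+* B) (z u : R) (𝔫 : Ideal R) (w c u' : B)
    (hz : ψ z = w * c) (hu : ψ u = w * u') (h𝔫 : 𝔫.map ψ = Ideal.span {w}) (k m : ℕ)
    (hkm : 1 ≤ k + m) :
    (Ideal.span {z} ⊔ Ideal.span {u} ^ k * 𝔫 ^ m).map ψ =
      Ideal.span {w} * Ideal.span {c, w ^ (k + m - 1) * u' ^ k} := by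
  obtain ⟨i, hi⟩ := Nat.exists_eq_add_of_le hkm
  rw [Ideal.map_sup, Ideal.map_mul, Ideal.map_pow, Ideal.map_pow, h𝔫, Ideal.map_span,
    Set.image_singleton, Ideal.map_span, Set.image_singleton, hz, hu, Ideal.span_singleton_pow,
    Ideal.span_singleton_pow, Ideal.span_singleton_mul_span_singleton, Ideal.span_insert,
    Ideal.mul_sup, Ideal.span_singleton_mul_span_singleton, Ideal.span_singleton_mul_span_singleton,
    hi, show 1 + i - 1 = i by omega]
  have e : (w * u') ^ k * w ^ m = w * (w ^ i * u' ^ k) := by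
    have hm : w ^ k * w ^ m = w * w ^ i := by rw [← pow_add, hi, pow_add, pow_one]
    rw [mul_pow, mul_right_comm, hm]
    ring
  rw [e]

/-- **The `u`-chart**: `ψ z = w (1 + w q)`, `ψ u = w`, `ψ(𝔫) = (w)` ⇒ `ψ((z) + uᵏ 𝔫ᵐ) = (w)` for
`k + m ≥ 1` (a Cartier divisor). [cite: StacksProject, Tag 080B] -/
theorem map_span_sup_pow_mul_pow_of_unit (ψ : R →+* B) (z u : R) (𝔫 : Ideal R) (w q : B)
    (hz : ψ z = w * (1 + w * q)) (hu : ψ u = w) (h𝔫 : 𝔫.map ψ = Ideal.span {w}) (k m : ℕ)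
    (hkm : 1 ≤ k + m) :
    (Ideal.span {z} ⊔ Ideal.span {u} ^ k * 𝔫 ^ m).map ψ = Ideal.span {w} := by
  rw [Ideal.map_sup, Ideal.map_mul, Ideal.map_pow, Ideal.map_pow, h𝔫, Ideal.map_span,
    Set.image_singleton, Ideal.map_span, Set.image_singleton, hz, hu, Ideal.span_singleton_pow,
    Ideal.span_singleton_pow, Ideal.span_singleton_mul_span_singleton, ← pow_add,
    ← Ideal.span_insert]
  exact span_pair_one_add_mul w q (k + m) hkm

end Generic

end ConeRung

end Summit.ResolutionOfSingularities.ResolutionOfSingularities.Theorems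

end
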